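import Summits.AtomisticToContinuum.Crystallization.Theorems.FreeSplittingCertificatesStrictSplittingRuleDefs
import Summits.AtomisticToContinuum.Crystallization.Theorems.FreeSplittingCertificatesStrictSplittingRuleDeficitBound
import Summits.AtomisticToContinuum.Crystallization.Theorems.FreeSplittingCertificatesStrictSplittingRuleCoarseGapLadder

/-!
# Line `close-packing` for crux `FreeSplittingCertificates.StrictSplittingRule` (stmt-AtomisticToContinuum-12560)
— ALTERNATIVE line registered by the crux-strategist (2026-08-17); the live line `birth` (lead c4) is untouched.
"Polytype selection is perturbative."

Route `FreeSplittingCertificates`, crux r3 `StrictSplittingRule` (the route's only open load-bearing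
item since `ShellRigidityHcp` closed).  The registered line `birth` cuts the crux by TOLERANCE into
S1 (a feasible finite-range rule gapped at ONE coarse tolerance toward the hcp shell — this bundles
global feasibility, i.e. crux r2 `FiniteRangeSplitting`, with POLYTYPE SELECTION: fcc-type sites must
pay `≈ e_fcc − e_hcp ≈ 7.25·10⁻⁵`) and S2 (the perturbative certificate at hcp-good sites).  S1 has no
worker ("promote-stub", leads c3/c4).

This skeleton cuts the same crux DIFFERENTLY, along the line between the two
mathematical regimes rather than between two tolerances toward one shell:

* `G` — **close-packing certificate** (polytype-FREE kernel): at the hcp-family minimiser, for every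
  hard core `δ` and all large radii, a feasible finite-range rule whose low-slack sites
  (`< e_∞ + c₀`) have a first shell within `a/100` of the stretched hcp shell `S(a,t)` OR of the
  stretched c-type (cuboctahedral) shell `C(a,t) = a·(fccKissingPattern stretched by 1+t along (1,1,1))` (inlined; `fccKissingPattern` and `hcpKissingPattern` share the hexagonal plane `x + y + z = 0`, so the stretch map of `target` applies verbatim).  It does not know which close packing
  wins: it is consistent with fcc, hcp or any Barlow stacking being the ground state, so the landed
  negative `StrictSplittingRule_false_of_bravaisGroundState` does not touch it.  It carries r2
  (feasibility) and "non-close-packed local order costs linearly" (icosahedral / frustrated,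
  mis-coordinated, `> 1 %`-strained shells) — the Kepler–Theil-type content.
* `F` — **polytype-selective perturbative certificate** (LOCAL): at `a/100`-hcp sites slack `≥ 0`
  and full strictness (this is the registered perturbative stub S2b at `η₀ = a/100`), and, NEW, at
  `a/100`-c-type sites slack `≥ c₁ > 0`; nothing is asked anywhere else (every rule has a bounded
  deficit on `δ`-separated configurations: `stub_deficitBound`, landed).  Every instance is a
  `≤ 1 %`-strained piece of a possibly FAULTED Barlow stacking around the site, or has a
  non-close-packed site within `R` to dump on; the budget at a c-type site is the `h/c` registry
  coupling `Δ₂ ≈ 7.27·10⁻⁵` carried by bonds of length `≤ 2h` between its two adjacent layers, and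
  `e_∞ ≤ e(hcp) < e(fcc)` (PeriodicUpperBound + certified lattice sums).  This is where hcp-vs-fcc
  lives, and it is refuted exactly when a Bravais (fcc) lattice attains `e_∞`.

COMPOSITION (sorry-free; stubs = the two children; the glue is also registered as the anchor stub
`stub_closePackingGlue`, landed at once in `Theorems/FreeSplittingCertificatesStrictSplittingRuleSplit.lean`): `G → F → StrictSplittingRule` by ONE convex mixing
`Φ := (1−λ)Φ_G + λΦ_F`, `λ := c₀/(2(c₀+D))` with `D` the universal deficit bound: sites that are
neither hcp- nor c-type keep slack `≥ c₀/2`, c-type sites get `≥ λc₁`, hcp-type sites inherit `Φ_F`'s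
non-negativity and strictness; `c(η) := min (c₀/2) (min (λc₁) (λc₂(η)))`.  The lattice parameters are
pinned rule-free by `HcpFamilyMin` exactly as in the registered line (S0 landed:
`hcpFamilyMinimiser_holds`).  Compared with `birth`: S1 ⇒ G (same rule; G's good set is larger) and
S1's polytype clause moves into F (F = S2b(a/100) + the c-type gap), so neither child is the crux or S1
reworded; G ∧ F and S1 ∧ S2 both give the crux.  [folklore]
-/

noncomputable section

namespace Summit.AtomisticToContinuum.Crystallization.Theorems.StrictSplittingRuleBirth

open scoped BigOperators Classical
open Literature.MathematicalPhysics.StatisticalMechanics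
open Literature.Geometry.DiscreteGeometry

/-! ## Registered stubs of line `close-packing` (the ONLY sorries of this file) -/

/-- **G · stub_closePackingCertificate** (open-problem; the polytype-FREE kernel — Kepler–Theil-type content + crux r2).
At the hcp-family minimiser `(a,h)`, `h = (1+t)a√(2/3)` (S0, landed), for every hard core `δ > 0` and all radii
`R ≥ R₀`: a pair-splitting rule, FEASIBLE on `δ`-separated configurations, and GAPPED AT CLOSE PACKING — a site with
weighted energy `< e_∞ + c₀` has its first shell `a/100`-close (up to `O(3)`) to the stretched hcp shell `S(a,t)` OR
to the stretched c-type (cuboctahedral) shell `C(a,t)`.  Consistent with ANY Barlow stacking being a ground state (the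
landed `Negative/FalseOfBravaisGroundState` does not touch it).  Why it might fail: Lennard-Jones ultimately frustrated
at the exact level (no finite-range feasible rule: Miękisz scenario), or a non-close-packed twelve-shell family
(torn icosahedra, cf. the ShellCensus negative 15929) that cannot be charged `≥ c₀` from surplus within `R`.
Sources: Miekisz1998, HolsztynskiSlawny1978, HalesDSP2012, arXiv:1407.0692 (Conj. 2.2), BlancLewin2015,
Literature.Barriers.AtomisticToContinuum.TetrahedralFrustration / IcosahedralClusters / KissingTwelveDegeneracy. -/
theorem stub_closePackingCertificate :
    ∀ δ : ℝ, 0 < δ → ∀ a h t : ℝ, 0 < a → |t| ≤ 1 / 100 → h = (1 + t) * a * Real.sqrt (2 / 3) →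
      HcpFamilyMin a h → ∃ R₀ : ℝ, ∀ R : ℝ, R₀ ≤ R →
        ∃ (Φ : (EuclideanSpace ℝ (Fin 3)) → Finset (EuclideanSpace ℝ (Fin 3)) → ℝ) (c₀ : ℝ), IsRule Φ ∧ 0 < c₀ ∧ Feasible δ R Φ ∧
          ∀ (N : ℕ) (x : Fin N → (EuclideanSpace ℝ (Fin 3))), Sep δ x → ∀ k : Fin N, siteE R Φ x k < eInf + c₀ →
            ShellCloseTo (a / 100) (shell a x k) (target a t) ∨
              ShellCloseTo (a / 100) (shell a x k) (fccKissingPattern.image fun u => a • (u + (t * (u 0 + u 1 + u 2) / 3) • intVec ![1, 1, 1])) := by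
  sorry

/-- **F · stub_polytypePerturbative** (XL, local / certified-numerics-sized; polytype selection is PERTURBATIVE).
At the family minimiser, for every hard core and all radii `R ≥ R₀`: a rule and `c₁ > 0` with (i) slack `≥ 0` and
full strictness at `a/100`-hcp sites — literally the live line's S2b at `η₀ = a/100` (H1 landed; H2⋆/H3⋆ in
progress), and (ii) NEW: slack `≥ c₁` at `a/100`-c-type sites (an fcc-type site pays wherever it sits: the `h/c`
registry coupling `Δ₂ ≈ 7.27·10⁻⁵` per c-layer site lives on bonds of length `≤ 2h` between its two adjacent layers;
`e_∞ ≤ e(hcp)` is PeriodicUpperBound, `e(hcp) < e(fcc)` is certified lattice sums, item 0670); nothing is asked at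
other sites (their deficit is bounded for every rule: `stub_deficitBound`, landed).  Every instance is a `≤ 1 %`-strained
piece of a possibly faulted Barlow stacking around the site, or has a non-close-packed site within `R` to dump on.
Why it might fail: `e_fcc ≤ e_hcp` for `V = r⁻¹²/12 − r⁻⁶/6` (then bulk fcc sites have slack `→ 0`; this is where
the Bravais negative bites), or no sitewise SOS of the hcp/fcc force constants under decaying transfers, or `1 %` is
outside the perturbative basin (then the shared constant `1/100` shrinks in both stubs — a one-token resplit).
Sources: Stillinger2001, SchwerdtfegerBurrowsSmits2021, arXiv:1705.01751, arXiv:2107.14020, FrieseckeTheil2002,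
EMing2006, Literature.Barriers.AtomisticToContinuum.ShortRangeStackingBlindness / HcpNotBravais. -/
theorem stub_polytypePerturbative :
    ∀ δ : ℝ, 0 < δ → ∀ a h t : ℝ, 0 < a → |t| ≤ 1 / 100 → h = (1 + t) * a * Real.sqrt (2 / 3) →
      HcpFamilyMin a h → ∃ R₀ : ℝ, ∀ R : ℝ, R₀ ≤ R →
        ∃ (Φ : (EuclideanSpace ℝ (Fin 3)) → Finset (EuclideanSpace ℝ (Fin 3)) → ℝ) (c₁ : ℝ), IsRule Φ ∧ 0 < c₁ ∧
          (∀ (N : ℕ) (x : Fin N → (EuclideanSpace ℝ (Fin 3))), Sep δ x → ∀ k : Fin N,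
              ShellCloseTo (a / 100) (shell a x k) (target a t) → eInf ≤ siteE R Φ x k) ∧
          (∀ (N : ℕ) (x : Fin N → (EuclideanSpace ℝ (Fin 3))), Sep δ x → ∀ k : Fin N,
              ShellCloseTo (a / 100) (shell a x k) (fccKissingPattern.image fun u => a • (u + (t * (u 0 + u 1 + u 2) / 3) • intVec ![1, 1, 1])) → eInf + c₁ ≤ siteE R Φ x k) ∧
          ∀ η : ℝ, 0 < η → ∃ c : ℝ, 0 < c ∧ ∀ (N : ℕ) (x : Fin N → (EuclideanSpace ℝ (Fin 3))), Sep δ x → ∀ k : Fin N,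
            ShellCloseTo (a / 100) (shell a x k) (target a t) → siteE R Φ x k < eInf + c →
              ShellCloseTo η (shell a x k) (target a t) := by
  sorry

/-! ## The composition (kernel-checked, no sorry) -/

/-- **The composition** `G → F → StrictSplittingRule` BY NAME: pin `(a,h,t)` by the landed S0
`hcpFamilyMinimiser_holds`; universal deficit `D` (`stub_deficitBound`, landed); common radius; ONE convex mixing
`Φ := (1−λ)Φ_G + λΦ_F`, `λ := c₀/(2(c₀+D))`; three site classes — neither hcp- nor c-type: slack `≥ c₀/2`; c-type:
`≥ λc₁`; hcp-type: `Φ_F`'s non-negativity and strictness; `c(η) := min (c₀/2) (min (λc₁) (λc₂(η)))`. -/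
theorem StrictSplittingRule_of_closePacking :
    (∀ δ : ℝ, 0 < δ → ∀ a h t : ℝ, 0 < a → |t| ≤ 1 / 100 → h = (1 + t) * a * Real.sqrt (2 / 3) →
      HcpFamilyMin a h → ∃ R₀ : ℝ, ∀ R : ℝ, R₀ ≤ R →
        ∃ (Φ : (EuclideanSpace ℝ (Fin 3)) → Finset (EuclideanSpace ℝ (Fin 3)) → ℝ) (c₀ : ℝ), IsRule Φ ∧ 0 < c₀ ∧ Feasible δ R Φ ∧
          ∀ (N : ℕ) (x : Fin N → (EuclideanSpace ℝ (Fin 3))), Sep δ x → ∀ k : Fin N, siteE R Φ x k < eInf + c₀ →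
            ShellCloseTo (a / 100) (shell a x k) (target a t) ∨
              ShellCloseTo (a / 100) (shell a x k) (fccKissingPattern.image fun u => a • (u + (t * (u 0 + u 1 + u 2) / 3) • intVec ![1, 1, 1]))) →
    (∀ δ : ℝ, 0 < δ → ∀ a h t : ℝ, 0 < a → |t| ≤ 1 / 100 → h = (1 + t) * a * Real.sqrt (2 / 3) →
      HcpFamilyMin a h → ∃ R₀ : ℝ, ∀ R : ℝ, R₀ ≤ R →
        ∃ (Φ : (EuclideanSpace ℝ (Fin 3)) → Finset (EuclideanSpace ℝ (Fin 3)) → ℝ) (c₁ : ℝ), IsRule Φ ∧ 0 < c₁ ∧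
          (∀ (N : ℕ) (x : Fin N → (EuclideanSpace ℝ (Fin 3))), Sep δ x → ∀ k : Fin N,
              ShellCloseTo (a / 100) (shell a x k) (target a t) → eInf ≤ siteE R Φ x k) ∧
          (∀ (N : ℕ) (x : Fin N → (EuclideanSpace ℝ (Fin 3))), Sep δ x → ∀ k : Fin N,
              ShellCloseTo (a / 100) (shell a x k) (fccKissingPattern.image fun u => a • (u + (t * (u 0 + u 1 + u 2) / 3) • intVec ![1, 1, 1])) → eInf + c₁ ≤ siteE R Φ x k) ∧
          ∀ η : ℝ, 0 < η → ∃ c : ℝ, 0 < c ∧ ∀ (N : ℕ) (x : Fin N → (EuclideanSpace ℝ (Fin 3))), Sep δ x → ∀ k : Fin N,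
            ShellCloseTo (a / 100) (shell a x k) (target a t) → siteE R Φ x k < eInf + c →
              ShellCloseTo η (shell a x k) (target a t)) →
    Summit.AtomisticToContinuum.Crystallization.Theses.FreeSplittingCertificates.StrictSplittingRule := by
  intro hG hF
  rw [strictSplittingRule_iff]
  intro δ hδ
  obtain ⟨a, h, t, ha, ht, hht, hmin⟩ := hcpFamilyMinimiser_holds
  obtain ⟨D, hD, hdef⟩ := stub_deficitBound δ hδ
  obtain ⟨R₁, hR₁⟩ := hG δ hδ a h t ha ht hht hmin
  obtain ⟨R₂, hR₂⟩ := hF δ hδ a h t ha ht hht hmin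
  -- common radius
  set R : ℝ := max (max R₁ R₂) 1 with hRdef
  have hRR₁ : R₁ ≤ R := le_trans (le_max_left _ _) (le_max_left _ _)
  have hRR₂ : R₂ ≤ R := le_trans (le_max_right _ _) (le_max_left _ _)
  have hRpos : 0 < R := lt_of_lt_of_le one_pos (le_max_right _ _)
  obtain ⟨Φ₁, c₀, hrule₁, hc₀, hfeas₁, hgap₁⟩ := hR₁ R hRR₁
  obtain ⟨Φ₂, c₁, hrule₂, hc₁, hgoodH, hgapC, hstrict₂⟩ := hR₂ R hRR₂
  have hdef₂ : ∀ (N : ℕ) (x : Fin N → (EuclideanSpace ℝ (Fin 3))), Sep δ x → ∀ k : Fin N, eInf - D ≤ siteE R Φ₂ x k :=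
    fun N x hx k => hdef R Φ₂ hrule₂ N x hx k
  -- mixing parameter
  have hcD : 0 < c₀ + D := by linarith
  set l : ℝ := c₀ / (2 * (c₀ + D)) with hl
  have hl0 : 0 < l := by positivity
  have hlkey : l * (c₀ + D) = c₀ / 2 := by
    rw [hl]; field_simp
  have hl1 : l ≤ 1 := by nlinarith [hlkey, hc₀, hD]
  have hl1' : 0 ≤ 1 - l := sub_nonneg.mpr hl1
  -- the three lower bounds on the mixture, by site class
  have lbH : ∀ (N : ℕ) (x : Fin N → (EuclideanSpace ℝ (Fin 3))), Sep δ x → ∀ i : Fin N,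
      ShellCloseTo (a / 100) (shell a x i) (target a t) → eInf ≤ siteE R (mix l Φ₁ Φ₂) x i := by
    intro N x hx i hH
    rw [siteE_mix]
    have e1 := hfeas₁ N x hx i
    have e2 := hgoodH N x hx i hH
    nlinarith [mul_le_mul_of_nonneg_left e1 hl1', mul_le_mul_of_nonneg_left e2 hl0.le]
  have lbC : ∀ (N : ℕ) (x : Fin N → (EuclideanSpace ℝ (Fin 3))), Sep δ x → ∀ i : Fin N,
      ShellCloseTo (a / 100) (shell a x i) (fccKissingPattern.image fun u => a • (u + (t * (u 0 + u 1 + u 2) / 3) • intVec ![1, 1, 1])) →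
        eInf + l * c₁ ≤ siteE R (mix l Φ₁ Φ₂) x i := by
    intro N x hx i hC
    rw [siteE_mix]
    have e1 := hfeas₁ N x hx i
    have e2 := hgapC N x hx i hC
    nlinarith [mul_le_mul_of_nonneg_left e1 hl1', mul_le_mul_of_nonneg_left e2 hl0.le]
  have lbB : ∀ (N : ℕ) (x : Fin N → (EuclideanSpace ℝ (Fin 3))), Sep δ x → ∀ i : Fin N,
      ¬ ShellCloseTo (a / 100) (shell a x i) (target a t) →
      ¬ ShellCloseTo (a / 100) (shell a x i) (fccKissingPattern.image fun u => a • (u + (t * (u 0 + u 1 + u 2) / 3) • intVec ![1, 1, 1])) →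
        eInf + c₀ / 2 ≤ siteE R (mix l Φ₁ Φ₂) x i := by
    intro N x hx i hH hC
    rw [siteE_mix]
    have e1 : eInf + c₀ ≤ siteE R Φ₁ x i := by
      refine not_lt.mp fun hh => ?_
      rcases hgap₁ N x hx i hh with h1 | h1
      · exact hH h1
      · exact hC h1
    have e2 := hdef₂ N x hx i
    nlinarith [mul_le_mul_of_nonneg_left e1 hl1', mul_le_mul_of_nonneg_left e2 hl0.le, hlkey]
  refine ⟨R, mix l Φ₁ Φ₂, a, t, hRpos, ha, ht, isRule_mix hl0.le hl1 hrule₁ hrule₂, ?_, ?_⟩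
  · -- feasibility of the mixture
    intro N x hx i
    by_cases hH : ShellCloseTo (a / 100) (shell a x i) (target a t)
    · exact lbH N x hx i hH
    · by_cases hC : ShellCloseTo (a / 100) (shell a x i) (fccKissingPattern.image fun u => a • (u + (t * (u 0 + u 1 + u 2) / 3) • intVec ![1, 1, 1]))
      · have := lbC N x hx i hC
        nlinarith [mul_pos hl0 hc₁]
      · have := lbB N x hx i hH hC
        linarith
  · -- strictness of the mixture
    intro η hη
    obtain ⟨c₂, hc₂, hstr⟩ := hstrict₂ η hη
    refine ⟨min (c₀ / 2) (min (l * c₁) (l * c₂)),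
      lt_min (by linarith) (lt_min (by positivity) (by positivity)), ?_⟩
    intro N x hx k hk
    have hmin1 : min (c₀ / 2) (min (l * c₁) (l * c₂)) ≤ c₀ / 2 := min_le_left _ _
    have hmin2 : min (c₀ / 2) (min (l * c₁) (l * c₂)) ≤ l * c₁ :=
      le_trans (min_le_right _ _) (min_le_left _ _)
    have hmin3 : min (c₀ / 2) (min (l * c₁) (l * c₂)) ≤ l * c₂ :=
      le_trans (min_le_right _ _) (min_le_right _ _)
    -- a low-slack site is hcp-type
    have hH : ShellCloseTo (a / 100) (shell a x k) (target a t) := by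
      by_contra hH
      by_cases hC : ShellCloseTo (a / 100) (shell a x k) (fccKissingPattern.image fun u => a • (u + (t * (u 0 + u 1 + u 2) / 3) • intVec ![1, 1, 1]))
      · have := lbC N x hx k hC
        linarith
      · have := lbB N x hx k hH hC
        linarith
    refine hstr N x hx k hH ?_
    rw [siteE_mix] at hk
    have e1 := hfeas₁ N x hx k
    have h3 : l * siteE R Φ₂ x k < l * (eInf + c₂) := by
      nlinarith [mul_le_mul_of_nonneg_left e1 hl1']
    exact lt_of_mul_lt_mul_left h3 hl0.le

/-- The line CLOSES MODULO ITS STUBS. -/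
theorem strictSplittingRule_of_closePacking_stubs :
    Summit.AtomisticToContinuum.Crystallization.Theses.FreeSplittingCertificates.StrictSplittingRule :=
  StrictSplittingRule_of_closePacking stub_closePackingCertificate stub_polytypePerturbative

/-- The live line's coarse stub S1 (gap toward the hcp shell at one tolerance `η₀ ≤ a/100`, WITH feasibility)
implies G with the same rule (closeness is monotone in the tolerance): G is WEAKER than S1; refuting G refutes S1. -/
theorem closePackingCertificate_of_coarseGap
    (h1 : ∀ δ : ℝ, 0 < δ → ∀ a h t : ℝ, 0 < a → |t| ≤ 1 / 100 → h = (1 + t) * a * Real.sqrt (2 / 3) →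
      HcpFamilyMin a h → ∃ η₀ : ℝ, 0 < η₀ ∧ η₀ ≤ a / 100 ∧ ∃ R₀ : ℝ, ∀ R : ℝ, R₀ ≤ R →
        ∃ (Φ : (EuclideanSpace ℝ (Fin 3)) → Finset (EuclideanSpace ℝ (Fin 3)) → ℝ) (c₀ : ℝ), IsRule Φ ∧ 0 < c₀ ∧ Feasible δ R Φ ∧
          ∀ (N : ℕ) (x : Fin N → (EuclideanSpace ℝ (Fin 3))), Sep δ x → ∀ k : Fin N,
            siteE R Φ x k < eInf + c₀ → ShellCloseTo η₀ (shell a x k) (target a t)) :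
    ∀ δ : ℝ, 0 < δ → ∀ a h t : ℝ, 0 < a → |t| ≤ 1 / 100 → h = (1 + t) * a * Real.sqrt (2 / 3) →
      HcpFamilyMin a h → ∃ R₀ : ℝ, ∀ R : ℝ, R₀ ≤ R →
        ∃ (Φ : (EuclideanSpace ℝ (Fin 3)) → Finset (EuclideanSpace ℝ (Fin 3)) → ℝ) (c₀ : ℝ), IsRule Φ ∧ 0 < c₀ ∧ Feasible δ R Φ ∧
          ∀ (N : ℕ) (x : Fin N → (EuclideanSpace ℝ (Fin 3))), Sep δ x → ∀ k : Fin N, siteE R Φ x k < eInf + c₀ →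
            ShellCloseTo (a / 100) (shell a x k) (target a t) ∨
              ShellCloseTo (a / 100) (shell a x k) (fccKissingPattern.image fun u => a • (u + (t * (u 0 + u 1 + u 2) / 3) • intVec ![1, 1, 1])) := by
  intro δ hδ a h t ha ht hht hmin
  obtain ⟨η₀, hη₀, hη₀a, R₀, hR₀⟩ := h1 δ hδ a h t ha ht hht hmin
  refine ⟨R₀, fun R hR => ?_⟩
  obtain ⟨Φ, c₀, hrule, hc₀, hfeas, hgap⟩ := hR₀ R hR
  refine ⟨Φ, c₀, hrule, hc₀, hfeas, fun N x hx k hk => Or.inl ?_⟩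
  obtain ⟨A, hA⟩ := hgap N x hx k hk
  exact ⟨A, hA.mono hη₀a⟩

end Summit.AtomisticToContinuum.Crystallization.Theorems.StrictSplittingRuleBirth

end
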